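import Summits.QuantumFields.BalabanUV.T4Continuum.Support.NE9PencilEndSharp
import Literature.MathematicalPhysics.QuantumFieldTheory.Balaban1983to89.T4HistoryLipschitzSegment

/-!
# NE9MajorantLipschitzSharp — the tree's TWO-CONFIGURATION cluster-sum Lipschitz bound under a common majorant at constant 1 (was 4):
# `‖E_{w_A}(𝒞) − E_{w_B}(𝒞)‖ ≤ ε·a(γ)e^{−δ}` from `|w_A|, |w_B| ≤ m`, `|w_A − w_B| ≤ ε·m`, KP for `2m` — by the SEGMENT mean value on the affine
# interpolation `w_B + z•(w_A − w_B)` (the segment points are CONVEX combinations, so the full Cauchy radius `1/ε` is available at each of them);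
# hence END #1's coupling two-point AND table two-point constants `4 ↦ 1` and the vacuum-subtracted END at `(2·clip·B₀ + 2·lip·B₀·qT, ω + 2·lipbar·B·τ̄)`

Cell `pub-balaban`, T4-DAG §6 row NE9; NE9 crux team (coordinator ruling «YM REDIRECT» e34b3e0c (2)), leaf lineage
`b2b-balaban-t4-ne9-formalise-leaf-06` generation 39; routes R3′∕R4 (the SHARED coupling half D2 and END #1's architecture).  CONTEXT: refuter
`PRICING-NE9.md` v7 §C′(3) («`touchDiffSum_le_of_majorant`'s 4 can go to 3 or 2 globally») and v9 T18∕Q-v9-1 ((L) half).  OBSERVATION (journal INTENT 5):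
in the tree's `T4ActivityLipschitz.touchDiffSum_le_of_majorant` (constant `4·ε`, Cauchy on the disc `‖z‖ < 1/ε` about `0` with the near∕far split at
`ε = ½`) the interpolation `w z = w_B + z•(w_A − w_B)` is a CONVEX combination at every point `x` of the real segment `[0,1]`, so `‖w x γ‖ ≤ m γ` there and
the disc of radius `1/ε` about EVERY segment point stays inside `‖w z γ‖ ≤ 2·m γ` — the zero-free region of KP for `2m`.  The owner's∕refuter's stadium
lemma `NE9PencilEndSharp.touchDiffSum_le_of_kp_open_family` (p256040 §C) on the open set `thickening (1/ε) (segment ℝ 0 1)` then gives `touchDiffSum ≤ a(γ)·ε`: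
constant ONE, same hypotheses, no split.  Consequences, all drop-in siblings of tree theorems with the SAME binders: `norm_clusterSum_sub_le_of_majorant`
(`4ε ↦ ε`), `T4HistoryLipschitzSegment.norm_newTerm_sub_le_of_twoPointKP` (`4·lip ↦ lip`), `NE9LastCouplingBridge.norm_newTerm_sub_le_of_couplingTwoPoint`
(`4·clip ↦ clip`), and END #1 = `NE9VacuumSubtractedBridge` ∕ `NE9BridgeSizeInduction` §3 re-threaded: (L) at `2·clip·B₀ + 2·lip·B₀·qT` (was `8·… + 8·…`),
`OutputLipschitz` at `2·lip·B₀` (was `8·lip·B₀`), the END at `ℓ = 2·clipbar·B + 2·lipbar·B·qTbar`, rate `ω + 2·lipbar·B·τ̄` — with the sibling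
`NE9TwoPointKPOfPencilSharp` (p256978, `lipbar = 1/(R₀ − s₀)`) this is the record floor `c_eff = 2` INSIDE END #1's own `TwoPointKP` architecture, and the
COUPLING part of the moduli constant `ℓ` drops by 4 for both co-leads (D2 is shared).

HONEST FRAMING (T4-DAG PAGE 1).  Rung (B)+1 of the FINITE-VOLUME T⁴ programme — NOT infinite volume, NOT a mass gap, NOT the Clay
problem.  NE9 (`T4OutputRate.NE9` ∧ `FadingMemory`) is a cell NEW ESTIMATE, NOT PRINTED in [I] = [Balaban1987RG1] (CMP **109**), [II] =
[Balaban1988RG2Cluster] (CMP **116**), and NOT PROVED for Bałaban's E^{(j)} («NE9 ⇐ the named binders»; row WALLED ON A MODEL O-NE9-1; spine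
PROVED 0∕9); a sharper constant in a CONDITIONAL END is not progress on the estimate itself.  HONEST DEPENDENCY (cell line, verbatim):
continuum YM on T⁴ ⇐ BetaPertH ∧ nine spine estimates (0/9 proved); BetaPertH ⇐ (D1) ∧ (D4) ∧ CAP+tail; G-an2-4 gates asym, D1 and NE2/3/4.
`FlowStep.BetaPertH`, (B), (B^μ) do not occur.  One-variable complex analysis over the tree's own KP ∕ cluster-expansion lemmas; no `def`, no Prop-valued
definition, no estimate of any object of the series; [II]∕[KP86] referred to for TYPES only (ABSOLUTE RULE).  0 sorry.

* §1 [folklore] **`touchDiffSum_le_of_majorant_sharp`** (`≤ ε·a γ`, the tree's binders VERBATIM) and **`norm_clusterSum_sub_le_of_majorant_sharp`**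
  (`≤ ε·a γ·e^{−δ}`).
* §2 [folklore] **`norm_newTerm_sub_le_of_twoPointKP_sharp`** (`≤ (lip k·‖Q − Q′‖)·a(pin X)·e^{−δ(X)}`) and **`norm_newTerm_sub_le_of_couplingTwoPoint_sharp`**
  (`≤ (clip k·|g k − g′ k|)·a(pin X)·e^{−δ(X)}`) — END #1's two lemmas with the factor 4 gone.
* (sibling file `NE9VacuumSubtractedBridgeFloor`) END #1 RE-THREADED at constant 1: (L) `2·clip·B₀ + 2·lip·B₀·qT`, output `2·lip·B₀`, the END at
  `ℓ = 2·clipbar·B + 2·lipbar·B·qTbar`, rate `ω + 2·lipbar·B·τ̄`, and its occupation-DERIVED form.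
DISGUISE TEST: two activity configurations under a common majorant, generic KP cluster sums, one complex variable; not NE9.
WHAT THIS DOES NOT DO: touches no activity, no species, no estimate of Bałaban's; `TwoPointKP`, `hCup`, `hTcup`, decay, pin budget, reading, `hreprV`,
size data stay DISPLAYED; the model O-NE9-1, (R-0)[scope], the display `z` untouched; KP for `2m` REMAINS the hypothesis of the coupling half (the SLACK of KP is
what the Cauchy radius `1/ε` consumes — KP for `m` alone gives no radius; refuter Q-v9-1's (L) half is thereby located precisely: «(L) on KP(m)» needs either
coupling holomorphy with its own majorant or a different mechanism).

References (TYPES only): [Balaban1988RG2Cluster] T. Bałaban, CMP **116** (1988) 1–22 — (2.13)–(2.15) pp. 14–15, Lemma 3 (2.38) p. 20, (2.40)–(2.41) p. 21;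
[Balaban1987RG1] CMP **109** (1987) — (1.18) p. 263, (2.12)–(2.14) p. 268; [KoteckyPreiss1986] CMP **103** (1986) 491–498.  Summits-side NEW work (LEAN
PLACEMENT RULE); imports the owner's `NE9PencilEndSharp` (p256040, the stadium lemma) and `T4HistoryLipschitzSegment` BY NAME; modifies nothing; 0 sorry.
Value = END #1's (shared) coupling-half constant and table constant `4 ↦ 1` with NO new displayed input, NOT summit progress.  Engine credit: the
stadium lemma is t4-ne9-refuter g7's (filed by the owner as p256040); the convexity observation and the re-threading are this file's.
-/

noncomputable section

namespace Summit.QuantumFields.BalabanUV.T4Continuum.NE9MajorantLipschitzSharp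

open scoped BigOperators ENNReal
open Metric Set Filter
open Literature.Probability.LatticeModels
open Literature.MathematicalPhysics.QuantumFieldTheory.Balaban1983to89
open Literature.MathematicalPhysics.QuantumFieldTheory.Balaban1983to89.T4OutputRate
open Literature.MathematicalPhysics.QuantumFieldTheory.Balaban1983to89.T4ActivityLipschitz
open Literature.MathematicalPhysics.QuantumFieldTheory.Balaban1983to89.T4HistoryLipschitzRecursion
open Literature.MathematicalPhysics.QuantumFieldTheory.Balaban1983to89.T4HistoryLipschitzOuter
open Literature.MathematicalPhysics.QuantumFieldTheory.Balaban1983to89.T4HistoryLipschitzActivity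
open Literature.MathematicalPhysics.QuantumFieldTheory.Balaban1983to89.T4HistoryLipschitzActivity (ClusterGeom)
open Literature.MathematicalPhysics.QuantumFieldTheory.Balaban1983to89.T4HistoryLipschitzSegment
open Summit.QuantumFields.BalabanUV.T4Continuum.NE9PencilEndSharp

/-! ## §1 The two-configuration Lipschitz bound under a common majorant at constant 1 -/

section Majorant

variable {P : Type*} [DecidableEq P] {inc : P → P → Prop} [DecidableRel inc]

/-- [folklore] **PINNED DIFFERENCE SUM UNDER A COMMON MAJORANT, CONSTANT 1** — the binders of `T4ActivityLipschitz.touchDiffSum_le_of_majorant` VERBATIM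
(`a, d ≥ 0`, `ε ≥ 0`, `‖wA‖, ‖wB‖ ≤ m` on `L`, `‖wA − wB‖ ≤ ε·m` on `L`, KP for `2m` with weights `a + d`) ⊢ `touchDiffSum inc wA wB d L γ ≤ ε·a γ` (the tree's
constant is `4·ε`).  The affine interpolation `w z = wB + z•(wA − wB)` is a convex combination at each `x ∈ [0,1]` (`‖w x γ‖ ≤ m γ`), so on the disc of radius
`R` about `x` one has `‖w z γ‖ ≤ (1 + R·ε)·m γ ≤ 2·m γ` whenever `R·ε ≤ 1`; KP for `2m` makes `thickening R (segment ℝ 0 1)` a region where the stadium lemma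
`NE9PencilEndSharp.touchDiffSum_le_of_kp_open_family` applies, bound `a γ / R`; `R := 1/ε` (and `R → ∞` when `ε = 0`). -/
theorem touchDiffSum_le_of_majorant_sharp [Std.Refl inc] [Std.Symm inc] {wA wB : P → ℂ} {m a d : P → ℝ}
    (ha : ∀ γ, 0 ≤ a γ) (hd : ∀ γ, 0 ≤ d γ) {L : Finset P} {ε : ℝ} (hε : 0 ≤ ε)
    (hA : ∀ γ ∈ L, ‖wA γ‖ ≤ m γ) (hB : ∀ γ ∈ L, ‖wB γ‖ ≤ m γ)
    (hAB : ∀ γ ∈ L, ‖wA γ - wB γ‖ ≤ ε * m γ)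
    (hKP : ∀ γ ∈ L, ∑ γ' ∈ L with inc γ' γ, 2 * m γ' * Real.exp (a γ' + d γ') ≤ a γ)
    {γ : P} (hγ : γ ∈ L) :
    touchDiffSum inc wA wB d L γ ≤ ε * a γ := by
  -- the affine interpolation and the bound `a γ / R` for every admissible Cauchy radius `R` with `R·ε ≤ 1`
  set w : ℂ → P → ℂ := fun z γ' => wB γ' + z * (wA γ' - wB γ') with hw
  have hm0 : ∀ γ' ∈ L, 0 ≤ m γ' := fun γ' hγ' => (norm_nonneg _).trans (hA γ' hγ')
  have key : ∀ R : ℝ, 0 < R → R * ε ≤ 1 → touchDiffSum inc wA wB d L γ ≤ a γ / R := by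
    intro R hR hRε
    set U : Set ℂ := thickening R (segment ℝ (0 : ℂ) 1) with hU
    have hUo : IsOpen U := isOpen_thickening
    have hseg : ∀ x ∈ segment ℝ (0 : ℂ) 1, ball x R ⊆ U := fun x hx z hz =>
      mem_thickening_iff.2 ⟨x, hx, mem_ball.1 hz⟩
    have hwd : ∀ γ' ∈ L, DifferentiableOn ℂ (fun z => w z γ') U := fun γ' _ =>
      ((differentiable_const _).add (differentiable_id.mul (differentiable_const _))).differentiableOn
    -- on a segment point the interpolation is a convex combination
    have hconv : ∀ x ∈ segment ℝ (0 : ℂ) 1, ∀ γ' ∈ L, ‖w x γ'‖ ≤ m γ' := by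
      rintro x ⟨p, q, hp, hq, hpq, rfl⟩ γ' hγ'
      have hx : p • (0 : ℂ) + q • (1 : ℂ) = ((q : ℝ) : ℂ) := by simp
      have hsplit : w (p • (0 : ℂ) + q • (1 : ℂ)) γ' = ((p : ℝ) : ℂ) * wB γ' + ((q : ℝ) : ℂ) * wA γ' := by
        simp only [hw, hx]
        have hp' : ((p : ℝ) : ℂ) = 1 - ((q : ℝ) : ℂ) := by
          rw [← Complex.ofReal_one, ← Complex.ofReal_sub]; congr 1; linarith
        rw [hp']; ring
      rw [hsplit]
      calc ‖((p : ℝ) : ℂ) * wB γ' + ((q : ℝ) : ℂ) * wA γ'‖ ≤ ‖((p : ℝ) : ℂ) * wB γ'‖ + ‖((q : ℝ) : ℂ) * wA γ'‖ := norm_add_le _ _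
        _ = p * ‖wB γ'‖ + q * ‖wA γ'‖ := by
            rw [norm_mul, norm_mul, Complex.norm_real, Complex.norm_real, Real.norm_of_nonneg hp, Real.norm_of_nonneg hq]
        _ ≤ p * m γ' + q * m γ' := add_le_add (mul_le_mul_of_nonneg_left (hB γ' hγ') hp) (mul_le_mul_of_nonneg_left (hA γ' hγ') hq)
        _ = m γ' := by rw [← add_mul, hpq, one_mul]
    -- on the thickening the activities stay below `2m`
    have h2m : ∀ z ∈ U, ∀ γ' ∈ L, ‖w z γ'‖ ≤ 2 * m γ' := by
      intro z hz γ' hγ'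
      obtain ⟨x, hx, hzx⟩ := mem_thickening_iff.1 hz
      have hdiff : w z γ' = w x γ' + (z - x) * (wA γ' - wB γ') := by simp only [hw]; ring
      rw [hdiff]
      calc ‖w x γ' + (z - x) * (wA γ' - wB γ')‖ ≤ ‖w x γ'‖ + ‖(z - x) * (wA γ' - wB γ')‖ := norm_add_le _ _
        _ ≤ m γ' + R * (ε * m γ') := by
            refine add_le_add (hconv x hx γ' hγ') ?_
            rw [norm_mul]
            exact mul_le_mul (by rw [← dist_eq_norm]; exact hzx.le) (hAB γ' hγ') (norm_nonneg _) hR.le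
        _ ≤ 2 * m γ' := by nlinarith [hm0 γ' hγ', mul_nonneg (mul_nonneg hR.le hε) (hm0 γ' hγ')]
    have hKPU : ∀ z ∈ U, ∀ γ₀ ∈ L, ∑ γ' ∈ L with inc γ' γ₀, ‖w z γ'‖ * Real.exp (a γ' + d γ') ≤ a γ₀ := by
      intro z hz γ₀ hγ₀
      refine le_trans (Finset.sum_le_sum fun γ' hγ' => ?_) (hKP γ₀ hγ₀)
      exact mul_le_mul_of_nonneg_right (h2m z hz γ' (Finset.mem_filter.1 hγ').1) (Real.exp_nonneg _)
    have h := touchDiffSum_le_of_kp_open_family (inc := inc) (w := w) ha hd hUo hR hseg hwd hKPU hγ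
    have h1 : w 1 = wA := by funext γ'; simp [hw]
    have h0 : w 0 = wB := by funext γ'; simp [hw]
    rwa [h1, h0] at h
  rcases hε.eq_or_lt with h0 | hpos
  · -- `ε = 0`: every radius is admissible, so the sum is `≤ a γ / R` for all `R > 0`, hence `≤ 0`
    rw [← h0, zero_mul]
    refine le_of_forall_pos_le_add fun η hη => ?_
    rw [zero_add]
    rcases (ha γ).eq_or_lt with ha0 | hapos
    · have := key 1 one_pos (by rw [← h0, mul_zero]; exact zero_le_one)
      rw [← ha0, zero_div] at this
      exact this.trans hη.le
    · have hR : 0 < a γ / η := div_pos hapos hη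
      have := key (a γ / η) hR (by rw [← h0, mul_zero]; exact zero_le_one)
      rwa [div_div_cancel₀ hapos.ne'] at this
  · have := key (1 / ε) (one_div_pos.2 hpos) (by rw [one_div_mul_cancel hpos.ne'])
    rwa [one_div, div_inv_eq_mul, mul_comm] at this

/-- [folklore] **`norm_clusterSum_sub_le_of_majorant` AT CONSTANT 1** — the tree's binders VERBATIM ⊢ `‖E_{wA}(𝒞) − E_{wB}(𝒞)‖ ≤ ε·a γ·e^{−δ}` (was `4·ε·…`). -/
theorem norm_clusterSum_sub_le_of_majorant_sharp [Std.Refl inc] [Std.Symm inc] {wA wB : P → ℂ} {m a d : P → ℝ}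
    (ha : ∀ γ, 0 ≤ a γ) (hd : ∀ γ, 0 ≤ d γ) {L : Finset P} {ε : ℝ} (hε : 0 ≤ ε)
    (hA : ∀ γ ∈ L, ‖wA γ‖ ≤ m γ) (hB : ∀ γ ∈ L, ‖wB γ‖ ≤ m γ)
    (hAB : ∀ γ ∈ L, ‖wA γ - wB γ‖ ≤ ε * m γ)
    (hKP : ∀ γ ∈ L, ∑ γ' ∈ L with inc γ' γ, 2 * m γ' * Real.exp (a γ' + d γ') ≤ a γ)
    {𝒞 : Finset (Finset P)} {γ : P} (hγ : γ ∈ L) (hsub : ∀ C ∈ 𝒞, C ⊆ L)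
    (hpin : ∀ C ∈ 𝒞, KPTouches inc C γ) {δ : ℝ} (hdec : ∀ C ∈ 𝒞, δ ≤ ∑ γ' ∈ C, d γ') :
    ‖clusterSum inc wA 𝒞 - clusterSum inc wB 𝒞‖ ≤ ε * a γ * Real.exp (-δ) := by
  have hloc := sum_norm_truncatedWeight_sub_le_touchDiffSum (inc := inc) (wA := wA) (wB := wB) d hsub hpin hdec
  have key := touchDiffSum_le_of_majorant_sharp (inc := inc) ha hd hε hA hB hAB hKP hγ
  calc ‖clusterSum inc wA 𝒞 - clusterSum inc wB 𝒞‖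
      ≤ ∑ C ∈ 𝒞, ‖truncatedWeight inc wA C - truncatedWeight inc wB C‖ := by
        unfold clusterSum
        rw [← Finset.sum_sub_distrib]
        exact norm_sum_le _ _
    _ ≤ touchDiffSum inc wA wB d L γ * Real.exp (-δ) := hloc
    _ ≤ ε * a γ * Real.exp (-δ) := mul_le_mul_of_nonneg_right key (Real.exp_nonneg _)

end Majorant

/-! ## §2 END #1's two-point lemmas at constant 1 -/

section NewTerm

variable {C : Carriers} (G : ClusterGeom C) {Bg : Type} {Pot : Type*} [NormedAddCommGroup Pot]

/-- [folklore] **THE TABLE TWO-POINT BOUND OF THE NEW TERM AT CONSTANT 1** — `T4HistoryLipschitzSegment.norm_newTerm_sub_le_of_twoPointKP`'s binders VERBATIM ⊢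
`‖newTerm Q − newTerm Q′‖ ≤ (lip k·‖Q − Q′‖)·a(pin X)·e^{−δ(X)}` (was `4·…`). -/
theorem norm_newTerm_sub_le_of_twoPointKP_sharp {W : Set (ℕ → ℝ)} {act : ℕ → ℝ → Bg → Pot → G.P → ℂ} {𝒜 : ℕ → Set Pot}
    {n : ℕ → ℝ → Bg → G.P → ℝ} {lip : ℕ → ℝ} {a d : G.P → ℝ} (hK : TwoPointKP G W act 𝒜 n lip a d)
    {δ : C.Dom → ℝ} (hdec : G.DecayExtract δ d) {g : ℕ → ℝ} (hg : g ∈ W) {k : ℕ} {U : Bg} {X : C.Dom}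
    (hX : C.scale X = k + 1) {Q Q' : Pot} (hQ : Q ∈ 𝒜 k) (hQ' : Q' ∈ 𝒜 k) :
    ‖G.newTerm act k (g k) U X Q - G.newTerm act k (g k) U X Q'‖ ≤
      (lip k * ‖Q - Q'‖) * a (G.pin X) * Real.exp (-(δ X)) := by
  obtain ⟨ha, hd, hlip0, hP⟩ := hK
  obtain ⟨hbd, hlip, hkp⟩ := hP g hg k U X hX
  exact norm_clusterSum_sub_le_of_majorant_sharp (inc := G.inc) ha hd (mul_nonneg (hlip0 k) (norm_nonneg (Q - Q')))
    (fun γ hγ => hbd Q hQ γ hγ) (fun γ hγ => hbd Q' hQ' γ hγ) (fun γ hγ => hlip Q hQ Q' hQ' γ hγ) hkp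
    (G.pin_mem X) (G.clus_sub X) (G.clus_pin X) (hdec X)

/-- [folklore] **THE COUPLING TWO-POINT BOUND OF THE NEW TERM AT CONSTANT 1** — `NE9LastCouplingBridge.norm_newTerm_sub_le_of_couplingTwoPoint`'s binders
VERBATIM ⊢ `‖newTerm_{g k}(Q) − newTerm_{g′ k}(Q)‖ ≤ (clip k·|g k − g′ k|)·a(pin X)·e^{−δ(X)}` (was `4·…`). -/
theorem norm_newTerm_sub_le_of_couplingTwoPoint_sharp {W : Set (ℕ → ℝ)} {act : ℕ → ℝ → Bg → Pot → G.P → ℂ}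
    {𝒜 : ℕ → Set Pot} {n : ℕ → ℝ → Bg → G.P → ℝ} {lip clip : ℕ → ℝ} {a d : G.P → ℝ}
    (hK : TwoPointKP G W act 𝒜 n lip a d) (hclip0 : ∀ k, 0 ≤ clip k)
    (hCup : ∀ g ∈ W, ∀ g' ∈ W, ∀ (k : ℕ) (U : Bg) (X : C.Dom), C.scale X = k + 1 → ∀ Q ∈ 𝒜 k, ∀ γ ∈ G.vol X,
      ‖act k (g k) U Q γ‖ ≤ n k (g' k) U γ ∧
        ‖act k (g k) U Q γ - act k (g' k) U Q γ‖ ≤ clip k * |g k - g' k| * n k (g' k) U γ)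
    {δ : C.Dom → ℝ} (hdec : G.DecayExtract δ d) {g g' : ℕ → ℝ} (hg : g ∈ W) (hg' : g' ∈ W) {k : ℕ} {U : Bg}
    {X : C.Dom} (hX : C.scale X = k + 1) {Q : Pot} (hQ : Q ∈ 𝒜 k) :
    ‖G.newTerm act k (g k) U X Q - G.newTerm act k (g' k) U X Q‖ ≤
      (clip k * |g k - g' k|) * a (G.pin X) * Real.exp (-(δ X)) := by
  obtain ⟨ha, hd, -, hP⟩ := hK
  obtain ⟨hbd', -, hkp'⟩ := hP g' hg' k U X hX
  have hcross := hCup g hg g' hg' k U X hX Q hQ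
  exact norm_clusterSum_sub_le_of_majorant_sharp (inc := G.inc) ha hd (mul_nonneg (hclip0 k) (abs_nonneg _))
    (fun γ hγ => (hcross γ hγ).1) (fun γ hγ => hbd' Q hQ γ hγ) (fun γ hγ => (hcross γ hγ).2) hkp'
    (G.pin_mem X) (G.clus_sub X) (G.clus_pin X) (hdec X)

end NewTerm

end Summit.QuantumFields.BalabanUV.T4Continuum.NE9MajorantLipschitzSharp

end
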